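import Literature.NumberTheory.EllipticCurves.BhargavaShankarSelmerTwoLimsupFrontierProofs
import Literature.NumberTheory.EllipticCurves.BhargavaShankarCongruenceTypeCountProofs
import Literature.NumberTheory.EllipticCurves.BhargavaShankarLocalSievePhiIntegralProofs
import HarnessLib

/-!
# Bhargava–Shankar, Thm 1.1 (`limsup` form): the discharge

`Proofs`-style file (theorems only: no definitions, no named facts). Source: M. Bhargava,
A. Shankar, *Binary quartic forms having bounded invariants, and the boundedness of the average
rank of elliptic curves*, Ann. of Math. (2) 181 (2015) 191–242 = arXiv:1006.1002
(`BhargavaShankarAnnals2015`; held text = v2, published text = v3).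

This file closes the named fact `heightAverageLE_card_selmerTwo` of `BSDSelmer` (bsd.S26):
`heightAverageLE_card_selmerTwo_holds` — **Thm 1.1 in `limsup` form** (for every `ε > 0` the
average of `#Sel^(2)(E_{A,B}/ℚ)` over the curves `E_{A,B}` of naive height `< X` is eventually
`≤ 3 + ε`). (Cor. 1.2, `averageRankLE_three_halves_holds`, is discharged in
`BhargavaShankarLocalSievePhiIntegralProofs` from the same inputs.)

The proof is the printed one, assembled from the tree along the paper's own architecture:

1. **Parametrization (§3.1 of v2 = §3.1 of v3).** Thm 3.5/5.6 (`#Sel₂ ↔ PGL₂(ℚ)`-classes of locally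
   soluble quartics with invariants `2⁴I, 2⁶J`; `bhargavaShankar_card_selmerTwo_eq_holds`, with the
   minimisation Lemmas 5.3–5.5), Props. 5.7–5.8 (curves with rational `2`-torsion are negligible;
   `bhargavaShankar_sum_card_selmerTwo_twoTorsion_le_holds`) and Lemma 5.15 (the number of curves
   of height `< X`; `card_heightFamilyBelow_asymptotic_holds`) reduce Thm 1.1 (`limsup`) to the
   upper half (U31) of display (31): `heightAverageLE_card_selmerTwo_of_sum_irredClassCount_le`.
2. **The upper-bound sieve (§2.7 proof of Thm 2.21 and proof of Thm 3.19, v3).** (U31) follows from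
   (D) the upper congruence count for `GL₂(ℤ)`-invariant weights modulo `N` and (F) the local
   integrals, via the weights `m = ∏_p m_p` (Prop. 3.6, `globalWeight_eq_finprod_localWeightAt`)
   and Brumer–Kramer (Lemma 5.16): `sum_irredClassCount_le_of_upperCongruenceCount`,
   packaged as `heightAverageLE_card_selmerTwo_of_upperCongruenceCount`.
3. **(D) = Thm 2.12, upper half (v3; Thm 2.11 of v2)**, from Thm 2.1 (Gauss's fundamental domain,
   averaging over `G₀`, the Jacobian `2/27`, cutting off the cusp, Lemmas 2.2–2.4) run inside
   congruence classes: `upperCongruenceTypeCount` (type by type), summed over the three types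
   (`upperCongruenceSetCount_of_typeCount`, `4/135 + 4/135 + 32/135 = 8/27`) and passed from sets
   to `[0,1]`-valued weights (`upperCongruenceCount_of_setCount`).
4. **(F) = Prop. 5.12 of v2 (Prop. 3.13/3.18 and proof of Thm 3.19 of v3)**: for every prime `p`,
   `∫_{V_{ℤ_p}} φ_p dμ_p = |2¹⁰/3³|_p · M_p(V,F)` — the `p`-adic Jacobian change of variables
   (Props. 3.11–3.12, the tube theorem `setLIntegral_autCard_tube` and
   `lintegral_eq_mul_lintegral_tsum_orbits`), the orbit/stabiliser dictionary (Lemmas 5.10–5.11,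
   `tsum_solubleFibreOrbits_eq`, `tsum_orbits_eq_localSelmerRatio`), integral representatives of
   soluble classes (`exists_integral_pgl2Equiv_of_mem_invariantPairsAdic`) and Brumer–Kramer:
   `BinaryQuartic.integral_sievePhi_eq` (`BhargavaShankarLocalSievePhiIntegralProofs`).

Nothing on this route uses the uniformity estimate (v2 Prop. 5.13 = v3 Thm 2.13), which is needed
only for the lower half of (31), i.e. for the `Tendsto` form `average_card_selmerTwo` (limit `= 3`).

## References

* M. Bhargava, A. Shankar, Ann. of Math. (2) 181 (2015) 191–242 = arXiv:1006.1002; v2 numbering: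
  Thm 1.1, Cor. 1.2, Thm 2.1, Thm 2.11, §5 (Thm 5.6, Props. 5.7–5.8, 5.12, display (31),
  Thm 5.14, Lemmas 5.15–5.16); published numbering: Thms 2.12, 2.21 (§2.7), Prop. 3.6, Cor. 3.8,
  Props. 3.9, 3.13, 3.18, Thm 3.19.
  [cite: BhargavaShankarAnnals2015, Thm 1.1 and Cor. 1.2 (proof: §5.4 display (31), arXiv:1006.1002v2 numbering; Thm 2.12, §2.7 and proof of Thm 3.19, published numbering)]
-/

noncomputable section

open scoped Classical Topology
open Filter Set MeasureTheory Finset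

namespace Literature.NumberTheory.EllipticCurves

open BinaryQuartic

/-- **(D), the upper congruence count for `GL₂(ℤ)`-invariant weights `Ψ : (ℤ/Nℤ)⁵ → [0,1]`**
(Bhargava–Shankar, Thm 2.12 upper half in the weighted form used in §2.7): for every modulus `N`,
every such `Ψ` and every `ε > 0`, eventually in `X`, for every finite set `T` of `GL₂(ℤ)`-orbits of
irreducible integral quartics of type `0`, `2+` or `1` and height `< X` and every choice `ρ` of
representatives, `Σ_{O ∈ T} Ψ(ρ(O) mod N) ≤ (ν(Ψ)·(8/27)(π²/6) + ε) X^{5/6}` with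
`ν(Ψ) = N⁻⁵ Σ_r Ψ(r)`. Obtained from the type-by-type set version `upperCongruenceTypeCount`
through `upperCongruenceSetCount_of_typeCount` and `upperCongruenceCount_of_setCount`.
[cite: BhargavaShankarAnnals2015, Thm 2.12 (published numbering; Thm 2.11 of arXiv:1006.1002v2), upper bound, and §2.7] -/
theorem BinaryQuartic.upperCongruenceCount (N : ℕ) [NeZero N] (Ψ : (Fin 5 → ZMod N) → ℝ)
    (hΨ0 : ∀ r, 0 ≤ Ψ r) (hΨ1 : ∀ r, Ψ r ≤ 1)
    (hΨinv : ∀ f g : BinaryQuartic ℤ, GL2ZEquiv f g →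
      Ψ (fun j => ((g.coeffs j : ℤ) : ZMod N)) = Ψ (fun j => ((f.coeffs j : ℤ) : ZMod N)))
    (ε : ℝ) (hε : 0 < ε) :
    ∀ᶠ X : ℝ in atTop,
      ∀ (T : Finset (Set (BinaryQuartic ℤ))) (ρ : Set (BinaryQuartic ℤ) → BinaryQuartic ℤ),
        (↑T ⊆ gl2zOrbit '' {f : BinaryQuartic ℤ |
            f ∈ fourRealRoots ∪ posDefinite ∪ twoRealRoots ∧ f.IsIrreducible ∧ f.height < X}) →
        (∀ O ∈ T, ρ O ∈ O) →
        ∑ O ∈ T, Ψ (fun j => (((ρ O).coeffs j : ℤ) : ZMod N)) ≤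
          ((∑ r : Fin 5 → ZMod N, Ψ r) / (N : ℝ) ^ 5 * (8 / 27 * (Real.pi ^ 2 / 6)) + ε) *
            X ^ (5 / 6 : ℝ) :=
  upperCongruenceCount_of_setCount
    (fun N _ S hS _ hε => upperCongruenceSetCount_of_typeCount
      (fun N _ S hS ε hε => upperCongruenceTypeCount N S hS ε hε) N S hS hε)
    N Ψ hΨ0 hΨ1 hΨinv hε

/-- **Bhargava–Shankar, Thm 1.1 in `limsup` form, discharged** (bsd.S26,
`heightAverageLE_card_selmerTwo`): when the elliptic curves `E_{A,B} : y² = x³ + Ax + B` over `ℚ`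
are ordered by naive height, for every `ε > 0` the average of `#Sel^(2)(E_{A,B}/ℚ)` over the
curves of height `< X` is `≤ 3 + ε` for all large `X`. Proof: the printed one — (D) the upper
half of Thm 2.12 (`BinaryQuartic.upperCongruenceCount`) and (F) the local densities
`∫ φ_p = |2¹⁰/3³|_p M_p(V,F)` (`BinaryQuartic.integral_sievePhi_eq`, Prop. 5.12 of v2) fed to the
upper-bound sieve and the parametrization (`heightAverageLE_card_selmerTwo_of_upperCongruenceCount`).
[cite: BhargavaShankarAnnals2015, Thm 1.1 (limsup half; proof of §5.4 via display (31), arXiv:1006.1002v2 numbering = proof of Thm 3.19, published numbering)] -/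
theorem heightAverageLE_card_selmerTwo_holds : heightAverageLE_card_selmerTwo :=
  heightAverageLE_card_selmerTwo_of_upperCongruenceCount
    (fun N _ Ψ hΨ0 hΨ1 hΨinv ε hε => BinaryQuartic.upperCongruenceCount N Ψ hΨ0 hΨ1 hΨinv ε hε)
    (fun p _ => BinaryQuartic.integral_sievePhi_eq p)

end Literature.NumberTheory.EllipticCurves

end
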